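import Summits.NavierStokesRegularity.FluidComputer.PalasekTowerGermHostSymmetry
import Literature.Analysis.FluidPDE.StrainedAzimuthalFlow
import Literature.Analysis.FluidPDE.AxisymNoSwirlScalarEq
import Literature.Analysis.FluidPDE.RadialCalculus
import Literature.Analysis.FluidPDE.PeriodicCylinderWordNorms

/-!
# The strict slot, I: the SPHERICAL SWIRL BLOB and the source of its pressure

Cell `ns-blowup`, seat `ns-palasek-19179-p2` (g0); second seat on the crux `EpisodeBaseG`
(item stmt-NavierStokesRegularity-19179) of the route `PalasekTowerBreakdown` — the HOST-INSTANCE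
typing of START-HERE-D0081 §C.3: an EXPLICIT profile in ecbridge-3's strict design slot
`Germ.LevelZeroData U ρ` (`PalasekTowerGermHost.lean`, p443639), whose non-vacuity was flagged OPEN
(«needs the sign of the nonlocal pressure work at the argmax»). LABEL: E–C typing (KERNEL calculus:
one definition with body, everything proved). WHAT THIS IS NOT: not Navier–Stokes evidence — a
PRESCRIBED compactly supported velocity profile and the algebra of its pressure source; nothing
about any flow, stage, `FirstEpisodeD`, `RungG 1` or blow-up.

## What is here

The spherical swirl blob of radial profile `f`:

  `sphSwirl f y = f(‖y‖²) • J y`,  `J y = (−y₁, y₀, 0)` (the tree's `rotGen`),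

i.e. azimuthal velocity `v_θ = f(|y|²) r_h` about the `e₂`-axis with a profile depending on the
SPHERICAL radius. It is smooth, compactly supported when `f` vanishes beyond `R²`, divergence free
(`isDivFree_sphSwirl`), of speed `≤ |f(‖y‖²)| ‖y‖` (`norm_sphSwirl_le`); its self-convection is
centripetal, `(W·∇)W = −f² x_h` (`convect_sphSwirl`), so that the source of its pressure potential
is

  `div(νΔW − (W·∇)W) = 2 f(u)² + 4 f(u) f'(u) ρ`,  `u = ‖y‖²`, `ρ = y₀² + y₁²`

(`divergence_drift_sphSwirl`), which is the image of the RADIAL function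
`blobH f R y = ½ ∫_{‖y‖²}^{R²} f²` under the constant-coefficient operator `−Δ + ∂₂²`
(`divergence_drift_sphSwirl_eq_blobH`). That last identity is what makes the exterior pressure of
the blob an EXACT quadrupole (sequel file, Newton's shell theorem).

References: A. J. Majda, A. L. Bertozzi, *Vorticity and Incompressible Flow* (CUP 2002), §1.8
Prop. 1.16 and §2.2.1 Example 2.1 (2.14) [cite: MajdaBertozziCUP2002, §1.8 Prop. 1.16];
S. Palasek, arXiv:2605.13827 §3.3 [cite: Palasek2026ElementaryModel, §3.3].
-/

noncomputable section

namespace Summit.NavierStokesRegularity.FluidComputer.PalasekTowerClayBridge.Slot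

open Set Function Filter Topology InnerProductSpace Metric MeasureTheory
open scoped Topology ContDiff RealInnerProductSpace Laplacian

open Literature.Analysis.FluidPDE Literature.Analysis.FluidPDE.StrainedAzimuthal
open Summit.NavierStokesRegularity.FluidComputer.PalasekTowerClayBridge.Germ

/-! ## §1 The spherical swirl blob -/

/-- **The spherical swirl blob** of radial profile `f`: `W(y) = f(‖y‖²) J y`, azimuthal about the
`e₂`-axis with a profile in the SPHERICAL radius.
[cite: MajdaBertozziCUP2002, §2.2.1 Example 2.1] -/
def sphSwirl (f : ℝ → ℝ) (y : EuclideanSpace ℝ (Fin 3)) : EuclideanSpace ℝ (Fin 3) :=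
  f (‖y‖ ^ 2) • rotGen y

variable {f f' : ℝ → ℝ}

/-- `⟪y, x_h(y)⟫ = ρ(y)`. [folklore] -/
theorem inner_self_hor (y : EuclideanSpace ℝ (Fin 3)) : ⟪y, hor y⟫ = rho y := by
  rw [rho_apply]
  simp [hor, EuclideanSpace.inner_eq_star_dotProduct, Fin.sum_univ_three, dotProduct]
  ring

/-- **Speed bound**: `‖W(y)‖ ≤ |f(‖y‖²)| ‖y‖`. [folklore] -/
theorem norm_sphSwirl_le (f : ℝ → ℝ) (y : EuclideanSpace ℝ (Fin 3)) :
    ‖sphSwirl f y‖ ≤ |f (‖y‖ ^ 2)| * ‖y‖ := by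
  rw [sphSwirl, norm_smul, Real.norm_eq_abs]
  exact mul_le_mul_of_nonneg_left (norm_rotGen_le_norm y) (abs_nonneg _)

/-- The blob vanishes where its profile does. [folklore] -/
theorem sphSwirl_eq_zero_of {R : ℝ} (hfR : ∀ u, R ^ 2 ≤ u → f u = 0) {y : EuclideanSpace ℝ (Fin 3)}
    (hy : R ≤ ‖y‖) (hR : 0 ≤ R) : sphSwirl f y = 0 := by
  rw [sphSwirl, hfR _ (by nlinarith [norm_nonneg y]), zero_smul]

/-- **Support**: if `f = 0` on `[R², ∞)` (`R ≥ 0`) then `tsupport W ⊆ B̄(0, R)`. [folklore] -/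
theorem tsupport_sphSwirl_subset {R : ℝ} (hR : 0 ≤ R) (hfR : ∀ u, R ^ 2 ≤ u → f u = 0) :
    tsupport (sphSwirl f) ⊆ closedBall (0 : EuclideanSpace ℝ (Fin 3)) R := by
  refine closure_minimal (fun y hy => ?_) isClosed_closedBall
  rw [mem_closedBall_zero_iff]
  by_contra h
  exact hy (sphSwirl_eq_zero_of hfR (not_le.1 h).le hR)

/-- **Compact support.** [folklore] -/
theorem hasCompactSupport_sphSwirl {R : ℝ} (hR : 0 ≤ R) (hfR : ∀ u, R ^ 2 ≤ u → f u = 0) :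
    HasCompactSupport (sphSwirl f) :=
  (isCompact_closedBall (0 : EuclideanSpace ℝ (Fin 3)) R).of_isClosed_subset (isClosed_tsupport _)
    (tsupport_sphSwirl_subset hR hfR)

/-- **Smoothness.** [folklore] -/
theorem contDiff_sphSwirl (hf : ContDiff ℝ ∞ f) : ContDiff ℝ ∞ (sphSwirl f) :=
  (hf.comp (contDiff_norm_sq ℝ)).smul contDiff_rotGen

/-- **The derivative**: `DW(y) v = 2 f'(‖y‖²) ⟪y, v⟫ J y + f(‖y‖²) J v`. [folklore] -/
theorem fderiv_sphSwirl_apply (hf : ∀ u, HasDerivAt f (f' u) u) (y v : EuclideanSpace ℝ (Fin 3)) :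
    fderiv ℝ (sphSwirl f) y v =
      (2 * f' (‖y‖ ^ 2) * ⟪y, v⟫) • rotGen y + f (‖y‖ ^ 2) • rotGen v := by
  have hd : DifferentiableAt ℝ (fun w : EuclideanSpace ℝ (Fin 3) => f (‖w‖ ^ 2)) y :=
    (hasFDerivAt_comp_norm_sq (hf _)).differentiableAt
  change fderiv ℝ (fun w => f (‖w‖ ^ 2) • rotGen w) y v = _
  rw [fderiv_smul_rotGen_apply hd, fderiv_comp_norm_sq_apply (hf _)]

/-- **The blob is divergence free.** [cite: MajdaBertozziCUP2002, §2.2.1 Example 2.1 (2.14)] -/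
theorem isDivFree_sphSwirl (hf : ∀ u, HasDerivAt f (f' u) u) :
    VectorCalculus.IsDivFree (sphSwirl f) := fun y => by
  rw [divergence_eq_sum_inner_fderiv (EuclideanSpace.basisFun (Fin 3) ℝ)]
  simp only [Fin.sum_univ_three, EuclideanSpace.basisFun_apply, fderiv_sphSwirl_apply hf,
    inner_add_right, inner_smul_right, EuclideanSpace.inner_single_left, map_one, one_mul,
    EuclideanSpace.inner_single_right]
  simp [rotGen]
  ring

/-- **The self-convection of the blob is centripetal**: `(W·∇)W (y) = −f(‖y‖²)² x_h(y)`.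
[cite: MajdaBertozziCUP2002, §2.2.1 Example 2.1 (2.14)] -/
theorem convect_sphSwirl (hf : ∀ u, HasDerivAt f (f' u) u) (y : EuclideanSpace ℝ (Fin 3)) :
    convect (sphSwirl f) (sphSwirl f) y = -(f (‖y‖ ^ 2) ^ 2 • hor y) := by
  have h0 : ⟪y, rotGen y⟫ = 0 := by rw [real_inner_comm, inner_rotGen_left]; ring
  rw [convect_apply, fderiv_sphSwirl_apply hf]
  rw [show sphSwirl f y = f (‖y‖ ^ 2) • rotGen y from rfl, inner_smul_right, h0,
    mul_zero, mul_zero, zero_smul, zero_add, rotGen_smul, rotGen_rotGen, smul_neg, smul_neg,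
    smul_smul, ← sq]


/-! ## §2 The divergence of the centripetal term -/

/-- `D(k • L)(x) v = (Dk(x) v) L x + k(x) L v` for a scalar `k` and a continuous linear `L`.
[folklore] -/
theorem fderiv_smul_clm_apply {k : EuclideanSpace ℝ (Fin 3) → ℝ}
    (L : EuclideanSpace ℝ (Fin 3) →L[ℝ] EuclideanSpace ℝ (Fin 3)) {x : EuclideanSpace ℝ (Fin 3)}
    (hk : DifferentiableAt ℝ k x) (v : EuclideanSpace ℝ (Fin 3)) :
    fderiv ℝ (fun y => k y • L y) x v = (fderiv ℝ k x v) • L x + k x • L v := by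
  rw [fderiv_fun_smul hk L.differentiableAt, L.fderiv, _root_.add_apply,
    _root_.smul_apply, ContinuousLinearMap.smulRight_apply, add_comm]

/-- The horizontal projection as a continuous linear map: `x_h = −J(Jx)`. [folklore] -/
def horL : EuclideanSpace ℝ (Fin 3) →L[ℝ] EuclideanSpace ℝ (Fin 3) := -(rotGenL.comp rotGenL)

/-- `horL x = x_h`. [folklore] -/
theorem horL_apply (x : EuclideanSpace ℝ (Fin 3)) : horL x = hor x := by
  simp [horL, rotGen_rotGen]

/-- **The divergence of a radial multiple of `x_h`**: `div (k(‖·‖²) x_h)(y) = 2 k'(u) ρ + 2 k(u)`,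
`u = ‖y‖²`, `ρ = y₀² + y₁²`. [folklore] -/
theorem divergence_radial_smul_hor {k k' : ℝ → ℝ} (hk : ∀ u, HasDerivAt k (k' u) u)
    (y : EuclideanSpace ℝ (Fin 3)) :
    VectorCalculus.divergence (fun z : EuclideanSpace ℝ (Fin 3) => k (‖z‖ ^ 2) • hor z) y =
      2 * k' (‖y‖ ^ 2) * rho y + 2 * k (‖y‖ ^ 2) := by
  have hfun : (fun z : EuclideanSpace ℝ (Fin 3) => k (‖z‖ ^ 2) • hor z) =
      fun z => k (‖z‖ ^ 2) • horL z := by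
    funext z; rw [horL_apply]
  have hd : DifferentiableAt ℝ (fun w : EuclideanSpace ℝ (Fin 3) => k (‖w‖ ^ 2)) y :=
    (hasFDerivAt_comp_norm_sq (hk _)).differentiableAt
  rw [hfun, divergence_eq_sum_inner_fderiv (EuclideanSpace.basisFun (Fin 3) ℝ)]
  simp only [Fin.sum_univ_three, EuclideanSpace.basisFun_apply, fderiv_smul_clm_apply horL hd]
  simp only [fderiv_comp_norm_sq_apply (hk _), horL_apply, inner_add_right, inner_smul_right,
    EuclideanSpace.inner_single_left, EuclideanSpace.inner_single_right, map_one, one_mul]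
  simp [hor, rho_apply]
  ring

/-- **The divergence of the blob's self-convection**:
`div((W·∇)W)(y) = −(4 f(u) f'(u) ρ + 2 f(u)²)`.
[cite: MajdaBertozziCUP2002, §2.2.1 Example 2.1 (2.14)] -/
theorem divergence_convect_sphSwirl (hf : ∀ u, HasDerivAt f (f' u) u)
    (y : EuclideanSpace ℝ (Fin 3)) :
    VectorCalculus.divergence (convect (sphSwirl f) (sphSwirl f)) y =
      -(4 * f (‖y‖ ^ 2) * f' (‖y‖ ^ 2) * rho y + 2 * f (‖y‖ ^ 2) ^ 2) := by
  have hfun : convect (sphSwirl f) (sphSwirl f) =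
      fun z : EuclideanSpace ℝ (Fin 3) => (-(f (‖z‖ ^ 2) * f (‖z‖ ^ 2))) • hor z := by
    funext z; rw [convect_sphSwirl hf, neg_smul, sq]
  have hk : ∀ u, HasDerivAt (fun u => -(f u * f u)) (-(f' u * f u + f u * f' u)) u := fun u =>
    ((hf u).mul (hf u)).neg
  rw [hfun, divergence_radial_smul_hor hk]
  ring

/-- **The source of the blob's pressure potential**: for a smooth profile,
`div(νΔW − (W·∇)W)(y) = 4 f(u) f'(u) ρ + 2 f(u)²` (`div ΔW = 0` as `W` is divergence free).
[cite: MajdaBertozziCUP2002, §1.8 Prop. 1.16] -/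
theorem divergence_drift_sphSwirl (hfs : ContDiff ℝ ∞ f) (hf : ∀ u, HasDerivAt f (f' u) u) (ν : ℝ)
    (y : EuclideanSpace ℝ (Fin 3)) :
    VectorCalculus.divergence (drift ν (sphSwirl f)) y =
      4 * f (‖y‖ ^ 2) * f' (‖y‖ ^ 2) * rho y + 2 * f (‖y‖ ^ 2) ^ 2 := by
  rw [divergence_drift (contDiff_sphSwirl hfs) (isDivFree_sphSwirl hf),
    divergence_convect_sphSwirl hf, neg_neg]

/-! ## §3 The radial potential `H` and the identity `div(drift W) = (−Δ + ∂₂²) H` -/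

/-- The radial primitive profile `h(u) = ½ ∫_u^c f(v)² dv`. [folklore] -/
def blobProfile (f : ℝ → ℝ) (c : ℝ) (u : ℝ) : ℝ :=
  2⁻¹ * ∫ v in u..c, f v ^ 2

/-- **The radial potential of the blob**: `H(y) = ½ ∫_{‖y‖²}^{c} f(v)² dv`. [folklore] -/
def blobH (f : ℝ → ℝ) (c : ℝ) (y : EuclideanSpace ℝ (Fin 3)) : ℝ :=
  blobProfile f c (‖y‖ ^ 2)

/-- `h' = −½ f²`. [folklore] -/
theorem hasDerivAt_blobProfile (hfc : Continuous f) (c u : ℝ) :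
    HasDerivAt (blobProfile f c) (-(2⁻¹ * f u ^ 2)) u := by
  have hc2 : Continuous fun v => f v ^ 2 := hfc.pow 2
  have h := intervalIntegral.integral_hasDerivAt_left (hc2.intervalIntegrable _ _)
    (hc2.stronglyMeasurableAtFilter _ _) hc2.continuousAt (a := u) (b := c)
  have h2 := h.const_mul (2⁻¹ : ℝ)
  show HasDerivAt (fun u => 2⁻¹ * ∫ v in u..c, f v ^ 2) (-(2⁻¹ * f u ^ 2)) u
  simpa [mul_neg] using h2

/-- The derivative of `h` as a function. [folklore] -/
theorem deriv_blobProfile (hfc : Continuous f) (c : ℝ) :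
    deriv (blobProfile f c) = fun u => -(2⁻¹ * f u ^ 2) :=
  funext fun u => (hasDerivAt_blobProfile hfc c u).deriv

/-- `h` is smooth when `f` is. [folklore] -/
theorem contDiff_blobProfile (hfs : ContDiff ℝ ∞ f) (c : ℝ) : ContDiff ℝ ∞ (blobProfile f c) := by
  rw [contDiff_infty_iff_deriv, deriv_blobProfile hfs.continuous]
  exact ⟨fun u => (hasDerivAt_blobProfile hfs.continuous c u).differentiableAt,
    (contDiff_const.mul (hfs.pow 2)).neg⟩

/-- `H` is smooth when `f` is. [folklore] -/
theorem contDiff_blobH (hfs : ContDiff ℝ ∞ f) (c : ℝ) : ContDiff ℝ ∞ (blobH f c) :=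
  (contDiff_blobProfile hfs c).comp (contDiff_norm_sq ℝ)

/-- `h(u) = 0` for `u ≥ c` when `f = 0` on `[c, ∞)`. [folklore] -/
theorem blobProfile_eq_zero_of_le {c : ℝ} (hfR : ∀ u, c ≤ u → f u = 0) {u : ℝ} (hu : c ≤ u) :
    blobProfile f c u = 0 := by
  rw [blobProfile, intervalIntegral.integral_of_ge hu]
  have : ∫ v in Set.Ioc c u, f v ^ 2 = 0 := by
    refine MeasureTheory.setIntegral_eq_zero_of_forall_eq_zero fun v hv => ?_
    rw [hfR v hv.1.le, zero_pow two_ne_zero]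
  rw [this, neg_zero, mul_zero]

/-- **Support of `H`**: if `f = 0` on `[R², ∞)` (`R ≥ 0`) then `H = 0` off `B(0, R)`. [folklore] -/
theorem blobH_eq_zero_of_le {R : ℝ} (hR : 0 ≤ R) (hfR : ∀ u, R ^ 2 ≤ u → f u = 0)
    {y : EuclideanSpace ℝ (Fin 3)} (hy : R ≤ ‖y‖) : blobH f (R ^ 2) y = 0 :=
  blobProfile_eq_zero_of_le hfR (by nlinarith [norm_nonneg y])

/-- `H` has compact support (profile vanishing on `[R², ∞)`). [folklore] -/
theorem hasCompactSupport_blobH {R : ℝ} (hR : 0 ≤ R) (hfR : ∀ u, R ^ 2 ≤ u → f u = 0) :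
    HasCompactSupport (blobH f (R ^ 2)) := by
  refine HasCompactSupport.intro (isCompact_closedBall (0 : EuclideanSpace ℝ (Fin 3)) R)
    fun y hy => ?_
  rw [mem_closedBall_zero_iff, not_le] at hy
  exact blobH_eq_zero_of_le hR hfR hy.le

/-- `H ≥ 0` when `c ≥ ‖y‖²`… in fact `h(u) ≥ 0` for `u ≤ c`. [folklore] -/
theorem blobProfile_nonneg {c u : ℝ} (hu : u ≤ c) : 0 ≤ blobProfile f c u := by
  unfold blobProfile
  refine mul_nonneg (by norm_num) (intervalIntegral.integral_nonneg hu fun v _ => sq_nonneg _)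

/-- **The Laplacian of `H`**: `ΔH(y) = −4 f(u) f'(u) u − 3 f(u)²`, `u = ‖y‖²`. [folklore] -/
theorem laplacian_blobH (hfc : Continuous f) (hf : ∀ u, HasDerivAt f (f' u) u) (c : ℝ)
    (y : EuclideanSpace ℝ (Fin 3)) :
    (Δ (blobH f c)) y = -(4 * f (‖y‖ ^ 2) * f' (‖y‖ ^ 2) * ‖y‖ ^ 2) - 3 * f (‖y‖ ^ 2) ^ 2 := by
  have h1 : ∀ σ ∈ (univ : Set ℝ), HasDerivAt (blobProfile f c) (-(2⁻¹ * f σ ^ 2)) σ :=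
    fun σ _ => hasDerivAt_blobProfile hfc c σ
  have h2 : HasDerivAt (fun σ => -(2⁻¹ * f σ ^ 2)) (-(f (‖y‖ ^ 2) * f' (‖y‖ ^ 2))) (‖y‖ ^ 2) := by
    have := (((hf (‖y‖ ^ 2)).pow 2).const_mul (2⁻¹ : ℝ)).neg
    refine this.congr_deriv ?_
    ring
  have h := laplacian_comp_norm_sq (E := EuclideanSpace ℝ (Fin 3)) isOpen_univ h1 (mem_univ _) h2
  rw [finrank_euclideanSpace, Fintype.card_fin] at h
  change (Δ (fun w : EuclideanSpace ℝ (Fin 3) => blobProfile f c (‖w‖ ^ 2))) y = _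
  rw [h]
  push_cast
  ring

/-- The first derivative of `H`: `DH(y) v = −f(u)² ⟪y, v⟫`. [folklore] -/
theorem fderiv_blobH_apply (hfc : Continuous f) (c : ℝ) (y v : EuclideanSpace ℝ (Fin 3)) :
    fderiv ℝ (blobH f c) y v = -(f (‖y‖ ^ 2) ^ 2) * ⟪y, v⟫ := by
  change fderiv ℝ (fun w : EuclideanSpace ℝ (Fin 3) => blobProfile f c (‖w‖ ^ 2)) y v = _
  rw [fderiv_comp_norm_sq_apply (hasDerivAt_blobProfile hfc c _)]
  ring

/-- **The second axial derivative of `H`**: `∂₂∂₂H(y) = −4 f(u) f'(u) y₂² − f(u)²`. [folklore] -/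
theorem fderiv_fderiv_blobH_axial (hfc : Continuous f) (hf : ∀ u, HasDerivAt f (f' u) u) (c : ℝ)
    (y : EuclideanSpace ℝ (Fin 3)) :
    fderiv ℝ (fun z => fderiv ℝ (blobH f c) z (EuclideanSpace.single 2 1)) y
        (EuclideanSpace.single 2 1) =
      -(4 * f (‖y‖ ^ 2) * f' (‖y‖ ^ 2) * y 2 ^ 2) - f (‖y‖ ^ 2) ^ 2 := by
  have hfun : (fun z : EuclideanSpace ℝ (Fin 3) =>
      fderiv ℝ (blobH f c) z (EuclideanSpace.single 2 1)) =
      fun z : EuclideanSpace ℝ (Fin 3) => -(f (‖z‖ ^ 2) ^ 2) * z 2 := by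
    funext z
    rw [fderiv_blobH_apply hfc, EuclideanSpace.inner_single_right]
    simp
  rw [hfun]
  have hk : ∀ u, HasDerivAt (fun u => -(f u ^ 2)) (-(f' u * f u + f u * f' u)) u := fun u => by
    have h := ((hf u).mul (hf u)).neg
    refine (h.congr_of_eventuallyEq (Eventually.of_forall fun v => ?_))
    simp [sq]
  have h1 : HasFDerivAt (fun z : EuclideanSpace ℝ (Fin 3) => -(f (‖z‖ ^ 2) ^ 2))
      ((2 * -(f' (‖y‖ ^ 2) * f (‖y‖ ^ 2) + f (‖y‖ ^ 2) * f' (‖y‖ ^ 2))) •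
        (innerSL ℝ y : EuclideanSpace ℝ (Fin 3) →L[ℝ] ℝ)) y := hasFDerivAt_comp_norm_sq (hk _)
  have h2 : HasFDerivAt (fun z : EuclideanSpace ℝ (Fin 3) => z 2) (proj 2) y := (proj 2).hasFDerivAt
  rw [(h1.fun_mul h2).fderiv]
  simp only [_root_.add_apply, _root_.smul_apply, smul_eq_mul, PiLp.proj_apply,
    innerSL_real_coe_apply_apply, EuclideanSpace.inner_single_right]
  simp
  ring

/-- `‖y‖² = ρ(y) + y₂²`. [folklore] -/
theorem norm_sq_eq_rho_add (y : EuclideanSpace ℝ (Fin 3)) : ‖y‖ ^ 2 = rho y + y 2 ^ 2 := by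
  rw [EuclideanSpace.real_norm_sq_eq, Fin.sum_univ_three, rho_apply]

/-- **THE SOURCE IS `(−Δ + ∂₂²)` OF A RADIAL FUNCTION**:
`div(νΔW − (W·∇)W)(y) = −ΔH(y) + ∂₂∂₂H(y)` with `H = blobH f c` (any `c`). This is the identity
behind the exact quadrupole pressure of the blob. [cite: MajdaBertozziCUP2002, §1.8 Prop. 1.16] -/
theorem divergence_drift_sphSwirl_eq_blobH (hfs : ContDiff ℝ ∞ f) (hf : ∀ u, HasDerivAt f (f' u) u)
    (ν c : ℝ) (y : EuclideanSpace ℝ (Fin 3)) :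
    VectorCalculus.divergence (drift ν (sphSwirl f)) y =
      -(Δ (blobH f c)) y +
        fderiv ℝ (fun z => fderiv ℝ (blobH f c) z (EuclideanSpace.single 2 1)) y
          (EuclideanSpace.single 2 1) := by
  rw [divergence_drift_sphSwirl hfs hf, laplacian_blobH hfs.continuous hf,
    fderiv_fderiv_blobH_axial hfs.continuous hf, norm_sq_eq_rho_add]
  ring

end Summit.NavierStokesRegularity.FluidComputer.PalasekTowerClayBridge.Slot

end
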